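import Literature.NumberTheory.Automorphic.RankinSelbergTorusIntegralComplex
import Literature.NumberTheory.Automorphic.AdelicSecondCountable
import HarnessLib

/-!
# The Euler factorisation of the unfolded Rankin–Selberg integral at a complex point: all good places

Topic `NumberTheory/Automorphic`; namespace `Literature.NumberTheory.Automorphic`. Proof file (theorems
only). `RankinSelbergTorusIntegralComplex` factors the Bochner torus integral
`Ψ(s) = rankinSelbergTorusIntegralC νA νK W Φ s` EXACTLY over every FINITE set `F` of good places:
`Ψ(s) = (∏_{v ∈ F} T_v(q_v^{-s})) · ∫_{B(F) × K} I_s`, with `T_v(q_v^{-s}) = P_{α_v, ᾱ_v}(q_v^{-s})⁻¹` the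
unramified local factor of `L^S(s, π × π̃)`. This file passes to the limit over `F ↑ {v ∉ S'}`:

* `iInter_unitBox_image_eq` — `⋂_F B(F) = B({v ∉ S'})` over the finite subsets `F` of `{v ∉ S'}`;
* `tendsto_setIntegral_unitBox_image` — `∫_{B(F) × K} I_s → ∫_{B({v ∉ S'}) × K} I_s` along `F ↑`
  (continuity of the Bochner integral along a decreasing family of sets, `tendsto_setIntegral_of_antitone`;
  the finite places are countable, `countable_heightOneSpectrum`);
* `rankinSelbergTorusIntegralC_eq_mul_setIntegral_of_hasProd` (**main**) — if the local factors
  `v ↦ P_{α_v, ᾱ_v}(q_v^{-s})⁻¹`, `v ∉ S'`, have the product `L` (a `HasProd`; for Satake families of a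
  cuspidal `π` and `re s > 1` this is `partialPairL S' α ᾱ s`, `hasProd_partialPairL`), then

    `Ψ(s) = L · ∫_{B({v ∉ S'}) × K} I_s`

  — the Euler factorisation `Ψ(s; W, W̄, Φ) = L^{S'}(s, π × π̃) · Ψ_{S'}(s)` of the unfolded global
  Rankin–Selberg integral into the partial `L`-function and the integral over the torus points which
  are units at all good places (the "`S'`-part", a product of the local integrals at `v ∈ S' ∪ ∞` for
  factorizable data), on the whole open half-plane where `I_s` is integrable and the product converges
  (Jacquet–Shalika (1981), §4, (4.?)–Thm. (5.3) proof; Cogdell (2004), Thm. 2.2 "Eulerian" with Thm. 3.3).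

## References

* H. Jacquet, J. A. Shalika, *On Euler products and the classification of automorphic
  representations I*, Amer. J. Math. 103 (1981), §2 Prop. (2.3), §4 [JacquetShalikaAJM1981].
* J. W. Cogdell, *Analytic theory of L-functions for GL_n*, in *An Introduction to the Langlands
  Program* (2004), §2.3 Thm. 2.2, §3 Thm. 3.3 [CogdellAnalyticTheory2004].
-/

noncomputable section

open MeasureTheory Measure NumberField IsDedekindDomain Matrix Set Filter Finset Topology
open scoped MatrixGroups ENNReal NNReal ComplexConjugate Pointwise
open Literature.RingTheory.SymmetricFunctions.SymmPoly
open Literature.NumberTheory.GaloisRepresentations (ideleGroup localUnits)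

namespace Literature.NumberTheory.Automorphic

section Limit

variable {n : ℕ} {K : Type} [Field K] [NumberField K]

/-- The unit box of the image of a finite set of good places. [folklore] -/
theorem unitBox_image_antitone (S' : Set (HeightOneSpectrum (𝓞 K))) :
    Antitone fun F : Finset {v : HeightOneSpectrum (𝓞 K) // v ∉ S'} =>
      unitBox (n := n) (K := K) (↑(F.map (Function.Embedding.subtype fun v => v ∉ S')) : Set (HeightOneSpectrum (𝓞 K))) := by
  intro F F' hFF'
  refine unitBox_mono ?_
  intro v hv
  rw [Finset.mem_coe, Finset.mem_map] at hv ⊢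
  obtain ⟨u, hu, rfl⟩ := hv
  exact ⟨u, hFF' hu, rfl⟩

/-- **`⋂_F B(F) = B({v ∉ S'})`** over the finite sets `F` of good places. [folklore] -/
theorem iInter_unitBox_image_eq (S' : Set (HeightOneSpectrum (𝓞 K))) :
    (⋂ F : Finset {v : HeightOneSpectrum (𝓞 K) // v ∉ S'},
        unitBox (n := n) (K := K) (↑(F.map (Function.Embedding.subtype fun v => v ∉ S')) : Set (HeightOneSpectrum (𝓞 K)))) =
      unitBox {v | v ∉ S'} := by
  ext a
  simp only [Set.mem_iInter]
  constructor
  · intro h w hw i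
    have hmem : w ∈ (↑(({⟨w, hw⟩} : Finset {v : HeightOneSpectrum (𝓞 K) // v ∉ S'}).map
        (Function.Embedding.subtype fun v => v ∉ S')) : Set (HeightOneSpectrum (𝓞 K))) := by
      rw [Finset.coe_map, Finset.coe_singleton, Set.image_singleton]
      exact Set.mem_singleton w
    exact h {⟨w, hw⟩} w hmem i
  · intro h F
    refine unitBox_mono (fun w hw => ?_) h
    rw [Finset.mem_coe, Finset.mem_map] at hw
    obtain ⟨u, -, rfl⟩ := hw
    exact u.2

variable [MeasurableSpace (ideleGroup K)] [BorelSpace (ideleGroup K)]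

-- the house local instances of `RankinSelbergTorusIntegral` (Borel structure of `GL_n(𝔸_K)`, second
-- countability of `𝔸_Kˣ` for the Borel structure of the finite product `(𝔸_Kˣ)ⁿ`); none overrides a
-- Mathlib instance
attribute [local instance] adelicBorel borelSpace_adelic locallyCompactSpace_adelic
  secondCountableTopology_gl_adelic secondCountableTopology_ideleGroup

variable (νA : Measure (Fin n → ideleGroup K)) [νA.IsMulLeftInvariant] [SFinite νA]
  (νK : Measure ↥(maximalCompactAdelic n K)) [SFinite νK]
  {W : GL (Fin n) (AdeleRing (𝓞 K) K) → ℂ} {Φ : (Fin n → AdeleRing (𝓞 K) K) → ℝ}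

omit [νA.IsMulLeftInvariant] [SFinite νA] [SFinite νK] in
/-- **The box integrals converge to the integral over the good-unit torus**: along the finite sets `F`
of good places, `∫_{B(F) × K} I_s → ∫_{B({v ∉ S'}) × K} I_s` (decreasing sets, integrable integrand).
[folklore] -/
theorem tendsto_setIntegral_unitBox_image (S' : Set (HeightOneSpectrum (𝓞 K))) {s : ℂ}
    (hint : Integrable (torusIntegrandC n K W Φ s) (νA.prod νK)) :
    Tendsto (fun F : Finset {v : HeightOneSpectrum (𝓞 K) // v ∉ S'} =>
        ∫ p in unitBox (↑(F.map (Function.Embedding.subtype fun v => v ∉ S')) : Set (HeightOneSpectrum (𝓞 K))) ×ˢ Set.univ,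
          torusIntegrandC n K W Φ s p ∂(νA.prod νK))
      atTop (𝓝 (∫ p in unitBox {v | v ∉ S'} ×ˢ Set.univ, torusIntegrandC n K W Φ s p ∂(νA.prod νK))) := by
  haveI : Countable (HeightOneSpectrum (𝓞 K)) := countable_heightOneSpectrum K
  have h := tendsto_setIntegral_of_antitone (μ := νA.prod νK) (f := torusIntegrandC n K W Φ s)
    (s := fun F : Finset {v : HeightOneSpectrum (𝓞 K) // v ∉ S'} =>
      unitBox (n := n) (K := K) (↑(F.map (Function.Embedding.subtype fun v => v ∉ S')) : Set (HeightOneSpectrum (𝓞 K))) ×ˢ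
        (Set.univ : Set ↥(maximalCompactAdelic n K)))
    (fun F => (measurableSet_unitBox _).prod MeasurableSet.univ)
    (fun F F' h => Set.prod_mono (unitBox_image_antitone S' h) subset_rfl) ⟨∅, hint.integrableOn⟩
  have hset : (⋂ F : Finset {v : HeightOneSpectrum (𝓞 K) // v ∉ S'},
      unitBox (n := n) (K := K) (↑(F.map (Function.Embedding.subtype fun v => v ∉ S')) : Set (HeightOneSpectrum (𝓞 K))) ×ˢ
        (Set.univ : Set ↥(maximalCompactAdelic n K))) = unitBox {v | v ∉ S'} ×ˢ Set.univ := by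
    rw [← iInter_unitBox_image_eq]
    ext p
    simp only [Set.mem_iInter, Set.mem_prod, Set.mem_univ, and_true]
  rwa [hset] at h

variable {v : HeightOneSpectrum (𝓞 K)} {ϖ : ∀ v : HeightOneSpectrum (𝓞 K), (v.adicCompletion K)ˣ}
  {x : HeightOneSpectrum (𝓞 K) → Fin n → ℂ}

/-- **The Euler factorisation of the unfolded Rankin–Selberg integral at a complex point into the
partial `L`-function and the `S'`-part.** Let `W` be an unramified Whittaker–Hecke datum at every
`v ∉ S'` with parameters `x_v` enumerating `α_v` and `‖W‖` central-invariant, `Φ ≥ 0` spherical and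
integrally supported off `S'`, `I_s` integrable and the real torus sums `T_v(q_v^{-re s})` finite off `S'`.
If the unramified local factors `P_{α_v, ᾱ_v}(q_v^{-s})⁻¹`, `v ∉ S'`, have the product `L`, then
`Ψ(s) = L · ∫_{B({v ∉ S'}) × K} I_s` (for every finite `F` of good places
`Ψ(s) = (∏_{v ∈ F} P_{α_v,ᾱ_v}(q_v^{-s})⁻¹) · ∫_{B(F) × K} I_s`, and both factors converge along `F ↑`).
With `L = partialPairL S' α ᾱ s` (`hasProd_partialPairL`, `re s > 1`) this is
`Ψ(s; W, W̄, Φ) = L^{S'}(s, π × π̃) · Ψ_{S'}(s)` (Jacquet–Shalika (1981), §4; Cogdell (2004), Thm. 2.2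
with Thm. 3.3). [cite: JacquetShalikaAJM1981, §2 Prop. (2.3), §4] [cite: CogdellAnalyticTheory2004, Thm. 2.2, Thm. 3.3] -/
theorem rankinSelbergTorusIntegralC_eq_mul_setIntegral_of_hasProd (hn : 0 < n)
    {S' : Set (HeightOneSpectrum (𝓞 K))} (hW : ∀ v ∉ S', IsTorusUnramifiedAt n K W v (ϖ v) (x v))
    (hWZ : ∀ (z : ideleGroup K) (g : GL (Fin n) (AdeleRing (𝓞 K) K)),
      ‖W (Matrix.GeneralLinearGroup.scalar (Fin n) z * g)‖ = ‖W g‖)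
    (hΦ : ∀ v ∉ S', IsLastRowSphericalAt n K Φ v)
    (hΦv : ∀ v ∉ S', ∀ y : Fin n → AdeleRing (𝓞 K) K, Φ y ≠ 0 → ∀ j, Valued.v ((y j).2 v) ≤ 1)
    (hΦ0 : ∀ y, 0 ≤ Φ y) {s : ℂ} (hint : Integrable (torusIntegrandC n K W Φ s) (νA.prod νK))
    (hT : ∀ v ∉ S', schurSelfSum (x v) ((v.residueCard : ℝ) ^ (-s.re)) ≠ ⊤)
    {α : HeightOneSpectrum (𝓞 K) → Multiset ℂ} (hx : ∀ v ∉ S', (univ : Finset (Fin n)).val.map (x v) = α v)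
    {L : ℂ} (hL : HasProd (fun u : {v : HeightOneSpectrum (𝓞 K) // v ∉ S'} =>
      ((satakePairPolynomial (α u.1) ((α u.1).map conj)).eval ((u.1.residueCard : ℂ) ^ (-s)))⁻¹) L) :
    rankinSelbergTorusIntegralC n K νA νK W Φ s =
      L * ∫ p in unitBox {v | v ∉ S'} ×ˢ Set.univ, torusIntegrandC n K W Φ s p ∂(νA.prod νK) := by
  -- for every finite `F`: `Ψ(s) = (∏_{u ∈ F} L_u) · ∫_{B(F) × K}`
  have hF : ∀ F : Finset {v : HeightOneSpectrum (𝓞 K) // v ∉ S'},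
      (∏ u ∈ F, ((satakePairPolynomial (α u.1) ((α u.1).map conj)).eval ((u.1.residueCard : ℂ) ^ (-s)))⁻¹) *
        ∫ p in unitBox (↑(F.map (Function.Embedding.subtype fun v => v ∉ S')) : Set (HeightOneSpectrum (𝓞 K))) ×ˢ Set.univ,
          torusIntegrandC n K W Φ s p ∂(νA.prod νK) =
      rankinSelbergTorusIntegralC n K νA νK W Φ s := by
    intro F
    have hmem : ∀ v ∈ F.map (Function.Embedding.subtype fun v => v ∉ S'), v ∉ S' := fun v hv => by
      obtain ⟨u, -, rfl⟩ := Finset.mem_map.1 hv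
      exact u.2
    rw [← prod_torusSumC_mul_setIntegral_eq_rankinSelbergTorusIntegralC νA νK hn
      (F.map (Function.Embedding.subtype fun v => v ∉ S'))
      (fun v hv => hW v (hmem v hv)) hWZ (fun v hv => hΦ v (hmem v hv)) (fun v hv => hΦv v (hmem v hv)) hΦ0 s
      hint, Finset.prod_map]
    congr 1
    refine Finset.prod_congr rfl fun u _ => ?_
    exact (torusSumC_eq_inv_eval_satakePairPolynomial (hT u.1 u.2) (hx u.1 u.2)).symm
  -- pass to the limit along `F ↑`
  have hlim : Tendsto (fun F : Finset {v : HeightOneSpectrum (𝓞 K) // v ∉ S'} =>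
      (∏ u ∈ F, ((satakePairPolynomial (α u.1) ((α u.1).map conj)).eval ((u.1.residueCard : ℂ) ^ (-s)))⁻¹) *
        ∫ p in unitBox (↑(F.map (Function.Embedding.subtype fun v => v ∉ S')) : Set (HeightOneSpectrum (𝓞 K))) ×ˢ Set.univ,
          torusIntegrandC n K W Φ s p ∂(νA.prod νK)) atTop
      (𝓝 (L * ∫ p in unitBox {v | v ∉ S'} ×ˢ Set.univ, torusIntegrandC n K W Φ s p ∂(νA.prod νK))) :=
    Filter.Tendsto.mul hL (tendsto_setIntegral_unitBox_image νA νK S' hint)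
  simp_rw [hF] at hlim
  exact tendsto_nhds_unique tendsto_const_nhds hlim

end Limit

end Literature.NumberTheory.Automorphic
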